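import Mathlib
import Literature.Analysis.FluidPDE.SteadyNSLatticePersistenceDrift
import Literature.Analysis.FluidPDE.LinearizedNSTorus
import Summits.AnomalousDissipation.AnomalousDissipation.Theorems.WindLineWindyGalerkinSteadyZerothLawNormsOfH1Limit
import Summits.AnomalousDissipation.AnomalousDissipation.Theorems.BaireTransferRobustLoudUpgradeStubRealKernel
import HarnessLib

/-!
# Tools for stub `stub_nondegenerateLoudOpen` of crux `WindLine.WindyGalerkinSteadyZerothLaw`
# (stmt-AnomalousDissipation-11414), line `registered`

Self-contained lemmas for the steady implicit-function theorem in a conserved-momentum leaf WITH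
nondegeneracy of the persisted state (`…NondegenerateLoudOpenPersist.lean`) and for the openness of
the nondegenerate-loud parameters (`…NondegenerateLoudOpen.lean`):

* §1 the FORWARD dictionary for the linearised steady operator: a classical kernel pair
  `(w, q)` of `L(ν,u)` at `0` (`Torus.LinNSResolventRel ν u 0 w 0`) solves, on the Fourier lattice,
  `ν4π²|k|² ŵ(k) + Π_k (N(û, ŵ) + N(ŵ, û))(k) = 0` (Leray multiplier kills `∇q`; transversality of
  `ŵ` from `div w = 0`); hence (`loudOpen_exists_kernel_of_isLinNSEigenvalue`, with the landed
  `RobustLoudUpgrade.Poly.RealKernel.stub_realKernel` supplying a REAL kernel field) a classical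
  eigenvector of `L(ν,u)` at `0` yields a NON-ZERO kernel vector of the leaf linearisation
  `4π²ν + (D + K_x)` on the state space `W ⊂ ℓ²(ℤ³; ℂ³)` — the converse of the landed
  `stub_linearisationInjective`;
* §2 injectivity of `T + B(x,·) + B(·,x)` for `x` near a point `x₀` where it is a linear
  homeomorphism (Neumann-type estimate through `‖L⁻¹‖` and the bilinear bound);
* §3 force points of `W` (Fourier families of smooth divergence-free mean-zero forces) and the
  strict budgets `∫|u|² < E`, `ε < ν‖∇u‖²` persist under `H¹`-small smooth perturbations
  (`loudOpen_budgetRadius`, the registered helper sub-goal of this file, from the landed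
  `stub_normsOfH1Limit` by a sequential argument).
-/

noncomputable section

-- D-0017: single-problem summit ⇒ the duplicated namespace segment is by design.
set_option linter.dupNamespace false

open scoped InnerProductSpace Topology ComplexConjugate
open MeasureTheory Filter UnitAddTorus
open Literature.Analysis.FunctionSpaces Literature.Analysis.FunctionSpaces.Torus
open Literature.Analysis.FunctionSpaces.EuclideanSpace
open Literature.Analysis.FluidPDE Literature.Analysis.FluidPDE.Torus
open Literature.Analysis.FluidPDE.ScalarFourier
open Literature.Analysis.FluidPDE.SteadyLattice Literature.Analysis.FluidPDE.SteadyLatticeDrift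

namespace Summit.AnomalousDissipation.AnomalousDissipation.Theorems.WindLineWindyGalerkinSteadyZerothLaw

/-- The flat three-torus (local notation). -/
local notation "𝕋³" => UnitAddTorus (Fin 3)
/-- Velocity values (local notation). -/
local notation "E³" => EuclideanSpace ℝ (Fin 3)
/-- Complex coefficient vectors (local notation). -/
local notation "ℂ³" => EuclideanSpace ℂ (Fin 3)
/-- Square-summable coefficient families `ℤ³ → ℂ³` (local notation). -/
local notation "ℓ2" => lp (fun _ : Fin 3 → ℤ => EuclideanSpace ℂ (Fin 3)) 2
/-- Physical coefficients `x̌(k) = x(k)/|k|²` of a family (local notation, the tree's `cf`). -/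
local notation "cf[" X "]" => ((fun mm : Fin 3 → ℤ => (((freqNormSq mm)⁻¹ : ℝ) : ℂ)) • (X : (Fin 3 → ℤ) → EuclideanSpace ℂ (Fin 3)))
/-- `k · v = ∑ⱼ kⱼ vⱼ` (local notation, the tree's `kdot`). -/
local notation "kdot[" k "," v "]" => (∑ jj : Fin 3, (((k : Fin 3 → ℤ) jj : ℤ) : ℂ) * (v : EuclideanSpace ℂ (Fin 3)) jj)
/-- The convective symbol `N(a, b)(k)` as a vector of `ℂ³` (local notation, the tree's `nl`). -/
local notation "nl[" a "," b "," k "]" =>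
  ((WithLp.toLp 2 (fun pp : Fin 3 => transportSym (fun jj mm => (a : (Fin 3 → ℤ) → EuclideanSpace ℂ (Fin 3)) mm jj)
    (fun mm => (b : (Fin 3 → ℤ) → EuclideanSpace ℂ (Fin 3)) mm pp) k)) : EuclideanSpace ℂ (Fin 3))

/-! ## §1 The forward dictionary for the linearised operator -/

/-- The Fourier coefficients of the zero field vanish. -/
theorem loudOpen_mFourierCoeff_zero (k : Fin 3 → ℤ) : mFourierCoeff (0 : 𝕋³ → ℂ³) k = 0 := by
  rw [show (0 : 𝕋³ → ℂ³) = (0 : ℂ) • (0 : 𝕋³ → ℂ³) by simp, mFourierCoeff_const_smul, zero_smul]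

/-- **Divergence-free complex fields have transversal coefficients**: `k · ŵ(k) = 0`
(`0 = 𝓕(div w)(k) = 2πi k·ŵ(k)`). -/
theorem loudOpen_kdot_mFourierCoeff_of_isDivFreeC {w : 𝕋³ → ℂ³} (hw : IsSmooth w) (hdiv : IsDivFreeC w)
    (k : Fin 3 → ℤ) : kdot[k, mFourierCoeff w k] = 0 := by
  set D : 𝕋³ → ℂ := fun z => ∑ l, partialDeriv l (fun x => w x l) z with hD
  have hwl : ∀ l, IsSmooth (fun x => w x l) := fun l =>
    hw.comp_clm ((EuclideanSpace.proj l : ℂ³ →L[ℂ] ℂ).restrictScalars ℝ)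
  have hD0 : D = fun _ => (0 : ℂ) := funext fun z => hdiv z
  have hDk : mFourierCoeff D k = 2 * Real.pi * Complex.I * kdot[k, mFourierCoeff w k] := by
    rw [hD, mFourierCoeff_finset_sum (f := fun l => partialDeriv l (fun x => w x l)) _
      (fun l _ => ((hwl l).partialDeriv l).integrable)]
    have h2 : ∀ l, mFourierCoeff (partialDeriv l (fun x => w x l)) k = dsym l k * mFourierCoeff w k l :=
      fun l => by
        rw [mFourierCoeff_partialDeriv (hwl l) l k, coeff_apply_complex hw k l, dsym_apply, smul_eq_mul]
    simp only [h2, dsym_apply]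
    rw [Finset.mul_sum]
    exact Finset.sum_congr rfl fun l _ => by ring
  have hDz : mFourierCoeff D k = 0 := by
    rw [hD0]
    simp [mFourierCoeff]
  rw [hDz] at hDk
  have hI : (2 * Real.pi * Complex.I : ℂ) ≠ 0 :=
    mul_ne_zero (mul_ne_zero two_ne_zero (by exact_mod_cast Real.pi_ne_zero)) Complex.I_ne_zero
  exact (mul_eq_zero.1 hDk.symm).resolve_left hI

/-- `Π_k` fixes the Fourier coefficients of a smooth divergence-free mean-zero real field. -/
theorem loudOpen_lerayCoeff_mFourierCoeff {f : 𝕋³ → E³} (hf : IsSmooth f) (hdf : IsDivFree f)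
    (h0 : HasZeroMean f) (k : Fin 3 → ℤ) :
    lerayCoeff k (mFourierCoeff (complexify ∘ f) k) = mFourierCoeff (complexify ∘ f) k := by
  by_cases hk : k = 0
  · subst hk
    rw [mFourierCoeff_complexify_zero_of_hasZeroMean hf h0, lerayCoeff_zero_vec]
  · exact lerayCoeff_of_kdot_eq_zero hk (hdf.sum_mul_mFourierCoeff_eq_zero hf k)

/-- **The forward dictionary for the linearised steady operator.**  If `(w, q)` is a classical
kernel pair of `L(ν,u)` at `0` in the mean-zero class (`LinNSResolventRel ν u 0 w 0`), then
`ν4π²|k|² ŵ(k) + Π_k (N(û, ŵ) + N(ŵ, û))(k) = 0` for every `k` (Fourier coefficients of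
`νΔw − (u·∇)w − (w·∇)u − ∇q = 0`, then the Leray multiplier: `Π_k k = 0`, `Π_k ŵ(k) = ŵ(k)`). -/
theorem loudOpen_fourier_eq_of_linNSResolventRel {ν : ℝ} {u : 𝕋³ → E³} (hu : IsSmooth u) {w : 𝕋³ → ℂ³}
    (h : LinNSResolventRel ν u 0 w 0) (k : Fin 3 → ℤ) :
    (((ν * (4 * Real.pi ^ 2 * freqNormSq k)) : ℝ) : ℂ) • mFourierCoeff w k +
      lerayCoeff k (nl[mFourierCoeff (complexify ∘ u), mFourierCoeff w, k] +
        nl[mFourierCoeff w, mFourierCoeff (complexify ∘ u), k]) = 0 := by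
  obtain ⟨hw, hdiv, -, q, hq, hE⟩ := h
  have hE0 : (fun y => linearizedNSOperator ν u w q y) = 0 := by
    funext y
    have := hE y
    rwa [zero_smul, sub_zero] at this
  have i1 : Integrable (fun y => laplacian w y) volume := hw.laplacian.integrable
  have i1' : Integrable ((ν : ℂ) • fun y => laplacian w y) volume := i1.smul (ν : ℂ)
  have i2 : Integrable (Torus.convect u w) volume := (hu.convect hw).integrable
  have i3 : Integrable (Torus.stretch w u) volume := (isSmooth_stretch hu hw).integrable
  have i4 : Integrable (Torus.gradientC q) volume :=
    Continuous.integrable_unitAddTorus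
      ((PiLp.continuous_toLp 2 _).comp (continuous_pi fun l => (hq.partialDeriv l).continuous))
  have hfun : (fun y => linearizedNSOperator ν u w q y) =
      ((ν : ℂ) • fun y => laplacian w y) - (Torus.convect u w + Torus.stretch w u) - Torus.gradientC q := by
    funext y
    simp only [Torus.linearizedNSOperator_apply, Pi.sub_apply, Pi.add_apply, Pi.smul_apply, Complex.coe_smul]
  have hk := congrArg (fun g : 𝕋³ → ℂ³ => mFourierCoeff g k) hE0
  rw [hfun, mFourierCoeff_sub (i1'.sub (i2.add i3)) i4, mFourierCoeff_sub i1' (i2.add i3), mFourierCoeff_add i2 i3,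
    mFourierCoeff_const_smul, mFourierCoeff_convect_complex hu hw k, mFourierCoeff_stretch hu hw k,
    mFourierCoeff_gradientC hq k, show (fun y => laplacian w y) = laplacian w from rfl,
    Torus.mFourierCoeff_laplacian hw k, loudOpen_mFourierCoeff_zero] at hk
  -- `hk : ν • -(4π²|k|² • ŵ k) - (N(û,ŵ) + N(ŵ,û)) - (2πi q̂ k) • k = 0`
  have hM : nl[mFourierCoeff (complexify ∘ u), mFourierCoeff w, k] +
      nl[mFourierCoeff w, mFourierCoeff (complexify ∘ u), k] =
      (-(ν : ℂ) * (((4 * Real.pi ^ 2 * freqNormSq k : ℝ)) : ℂ)) • mFourierCoeff w k -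
        (2 * Real.pi * Complex.I * mFourierCoeff q k) • Torus.freqVec k := by
    rw [neg_mul, neg_smul, ← smul_smul, ← smul_neg]
    linear_combination (norm := module) -hk
  by_cases hk0 : k = 0
  · subst hk0
    rw [freqNormSq_zero, Torus.lerayCoeff_zero]
    simp
  · have htr : kdot[k, mFourierCoeff w k] = 0 := loudOpen_kdot_mFourierCoeff_of_isDivFreeC hw hdiv k
    rw [hM, lerayCoeff_sub', lerayCoeff_smul', lerayCoeff_smul', lerayCoeff_freqVec, smul_zero, sub_zero,
      lerayCoeff_of_kdot_eq_zero hk0 htr, ← add_smul]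
    rw [show (((ν * (4 * Real.pi ^ 2 * freqNormSq k)) : ℝ) : ℂ) +
        -(ν : ℂ) * (((4 * Real.pi ^ 2 * freqNormSq k : ℝ)) : ℂ) = 0 by push_cast; ring, zero_smul]

/-- **A classical eigenvector of `L(ν,u)` at `0` yields a non-zero kernel vector of the leaf
linearisation on `W`** (converse of the landed `stub_linearisationInjective`).  With `a = 𝓕u`,
a point `x ∈ W` with `cf x = a°` (punctured family), the bilinear map `B` (coordinates
`Π N(x̌, y̌)`), the drift `D` of the mean `a(0)` and `K w = B(x,w) + B(w,x)`: a classical eigenvector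
gives a non-zero REAL kernel field `v` (`stub_realKernel`); `b = 𝓕v` is rapidly decaying,
conjugate symmetric, transversal, without zero mode and solves the linearised lattice equation
against `a` (`loudOpen_fourier_eq_of_linNSResolventRel`); the element `w = (|k|² b(k))_k ∈ W` is then a
non-zero kernel vector of `4π²ν + (D + K)` (`leray_nl_linearised_update` splits `a = a° + δ₀ a(0)`). -/
theorem loudOpen_exists_kernel_of_isLinNSEigenvalue (W : Submodule ℝ ℓ2)
    (hW : ∀ x : ℓ2, x ∈ W ↔ ((x : (Fin 3 → ℤ) → ℂ³) 0 = 0 ∧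
      (∀ kk : Fin 3 → ℤ, kdot[kk, (x : (Fin 3 → ℤ) → ℂ³) kk] = 0) ∧ IsConjSymm (x : (Fin 3 → ℤ) → ℂ³)))
    (B : W → W → W)
    (hB : ∀ x y : W, (((B x y : W) : ℓ2) : (Fin 3 → ℤ) → ℂ³) = fun k =>
      lerayCoeff k nl[cf[((x : ℓ2) : (Fin 3 → ℤ) → ℂ³)], cf[((y : ℓ2) : (Fin 3 → ℤ) → ℂ³)], k])
    (ν : ℝ) (u : 𝕋³ → E³) (D K : W →L[ℝ] W) (x : W) (hu : IsSmooth u)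
    (hD : ∀ y : W, (((D y : W) : ℓ2) : (Fin 3 → ℤ) → ℂ³) = fun k =>
      (2 * Real.pi * Complex.I * kdot[k, mFourierCoeff (complexify ∘ u) 0]) • cf[((y : ℓ2) : (Fin 3 → ℤ) → ℂ³)] k)
    (hKw : ∀ w, K w = B x w + B w x)
    (hcf : cf[((x : ℓ2) : (Fin 3 → ℤ) → ℂ³)] = Function.update (mFourierCoeff (complexify ∘ u)) 0 0)
    (hev : IsLinNSEigenvalue ν u 0) :
    ∃ w : W, w ≠ 0 ∧ (4 * Real.pi ^ 2 * ν) • w + (D + K) w = 0 := by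
  obtain ⟨v, hv0, hrel⟩ := RobustLoudUpgrade.Poly.RealKernel.stub_realKernel ν u hu hev
  have hcv : RobustLoudUpgrade.cplx v = complexify ∘ v :=
    funext fun y => realToComplex_eq_complexify (v y)
  rw [hcv] at hrel
  have ⟨hws, hdivC, hmean, _⟩ := hrel
  have hv : IsSmooth v := by
    have h := hws.comp_clm EuclideanSpace.realPart
    rwa [show (EuclideanSpace.realPart ∘ (complexify ∘ v) : 𝕋³ → E³) = v from
      funext fun y => EuclideanSpace.realPart_complexify (v y)] at h
  set b : (Fin 3 → ℤ) → ℂ³ := mFourierCoeff (complexify ∘ v) with hb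
  have har : RapidDecay (mFourierCoeff (complexify ∘ u)) := hu.complexify_comp.rapidDecay_mFourierCoeff
  have hbr : RapidDecay b := hws.rapidDecay_mFourierCoeff
  have hb0 : b 0 = 0 := SteadyLattice.mFourierCoeff_zero_of_hasZeroMean hmean
  have hbt : ∀ kk : Fin 3 → ℤ, kdot[kk, b kk] = 0 := fun kk => loudOpen_kdot_mFourierCoeff_of_isDivFreeC hws hdivC kk
  have hbcs : IsConjSymm b := isConjSymm_mFourierCoeff hv.integrable
  -- the lattice vector `X k = |k|² b k`
  set X : (Fin 3 → ℤ) → ℂ³ := fun k => ((freqNormSq k : ℝ) : ℂ) • b k with hX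
  have hXr : RapidDecay X := by
    refine hbr.of_norm_le_mul_pow (C := 1) (s := 1) fun k => ?_
    rw [hX]
    dsimp only
    rw [norm_smul, Complex.norm_real, Real.norm_of_nonneg (freqNormSq_nonneg k), one_mul, pow_one]
    exact mul_le_mul_of_nonneg_right (by linarith [freqNormSq_nonneg k]) (norm_nonneg _)
  have hXV : ((X : (Fin 3 → ℤ) → ℂ³) 0 = 0 ∧ (∀ kk : Fin 3 → ℤ, kdot[kk, (X : (Fin 3 → ℤ) → ℂ³) kk] = 0) ∧
      IsConjSymm (X : (Fin 3 → ℤ) → ℂ³)) := by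
    refine ⟨by simp [hX, freqNormSq_zero], fun k => by rw [hX]; dsimp only; rw [kdot_smul, hbt k, mul_zero],
      fun k => ?_⟩
    rw [hX]
    dsimp only
    rw [freqNormSq_neg, hbcs k, conjVec_smul, Complex.conj_ofReal]
  set w : W := ⟨⟨X, memℓp_two_of_rapidDecay hXr⟩, (hW _).2 hXV⟩ with hwdef
  have hw : ((w : ℓ2) : (Fin 3 → ℤ) → ℂ³) = X := rfl
  have hcfw : cf[((w : ℓ2) : (Fin 3 → ℤ) → ℂ³)] = b := by rw [hw, hX]; exact cf_weight_smul hb0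
  refine ⟨w, fun hw0 => hv0 ?_, ?_⟩
  · -- `w = 0` forces `b = 0`, hence `v = 0`
    have hbz : b = 0 := by
      rw [← hcfw, hw0, Submodule.coe_zero, lp.coeFn_zero]
      funext k
      rw [cf_apply, Pi.zero_apply, smul_zero]
    have hcz : (complexify ∘ v : 𝕋³ → ℂ³) = 0 :=
      eq_zero_of_forall_mFourierCoeff_eq_zero hws.continuous fun k => by
        rw [show mFourierCoeff (complexify ∘ v) k = b k from rfl, hbz, Pi.zero_apply]
    funext y
    have hy := congrFun hcz y
    simp only [Function.comp_apply, Pi.zero_apply] at hy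
    exact complexify_injective (by rw [hy, Pi.zero_apply, map_zero])
  · -- the kernel equation, coordinatewise
    have hupd := leray_nl_linearised_update har (w : ℓ2) (W_trans hW w)
    rw [hcfw] at hupd
    have heq := loudOpen_fourier_eq_of_linNSResolventRel hu hrel
    refine Subtype.ext (lp.ext (funext fun k => ?_))
    rw [coeW_add, add_apply, coeW_add, hKw, coeW_add, coeW_smul, hB, hB, hD, hcf,
      Submodule.coe_zero, lp.coeFn_zero, hcfw]
    simp only [Pi.add_apply, Pi.smul_apply, Pi.zero_apply]
    have hk := heq k
    rw [← hb, hupd k] at hk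
    rw [hw, hX]
    dsimp only
    rw [← Complex.coe_smul, smul_smul, ← Complex.ofReal_mul,
      show 4 * Real.pi ^ 2 * ν * freqNormSq k = ν * (4 * Real.pi ^ 2 * freqNormSq k) by ring]
    linear_combination (norm := module) hk

/-! ## §2 Injectivity near a linear homeomorphism -/

/-- **Injectivity is open along the base point of a bilinear linearisation.**  If
`L = T + B(x₀,·) + B(·,x₀)` is a linear homeomorphism, then `T + B(x,·) + B(·,x)` is injective for
every `x` with `‖x − x₀‖ < ρ`, `ρ = (2C(‖L⁻¹‖+1))⁻¹` (`C` the bilinear bound): a kernel vector `w`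
has `L w = −(B(x−x₀,w) + B(w,x−x₀))`, so `‖w‖ ≤ ‖L⁻¹‖·2C‖x−x₀‖‖w‖ < ‖w‖`. -/
theorem loudOpen_injective_near {E : Type*} [NormedAddCommGroup E] [NormedSpace ℝ E] {B : E → E → E}
    (hBb : IsBoundedBilinearMap ℝ (fun p : E × E => B p.1 p.2)) (T : E →L[ℝ] E) (L : E ≃L[ℝ] E) (x₀ : E)
    (hL : ∀ w, L w = T w + (B x₀ w + B w x₀)) :
    ∃ ρ : ℝ, 0 < ρ ∧ ∀ x : E, ‖x - x₀‖ < ρ → ∀ w : E, T w + (B x w + B w x) = 0 → w = 0 := by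
  obtain ⟨C, hC0, hC⟩ := hBb.bound
  set M : ℝ := ‖(L.symm : E →L[ℝ] E)‖ with hM
  have hM0 : 0 ≤ M := norm_nonneg _
  refine ⟨(2 * C * (M + 1))⁻¹, by positivity, fun x hx w hw => ?_⟩
  set Φ : E →L[ℝ] E →L[ℝ] E := hBb.toContinuousLinearMap with hΦ
  have hΦa : ∀ y z, Φ y z = B y z := fun y z => hBb.toContinuousLinearMap_apply y z
  have e1 : B x w = B x₀ w + B (x - x₀) w := by
    rw [← hΦa, ← hΦa, ← hΦa, ← add_apply, ← map_add, add_sub_cancel]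
  have e2 : B w x = B w x₀ + B w (x - x₀) := by
    rw [← hΦa, ← hΦa, ← hΦa, ← map_add, add_sub_cancel]
  have h1 : L w = -(B (x - x₀) w + B w (x - x₀)) := by
    rw [hL]
    rw [e1, e2] at hw
    calc T w + (B x₀ w + B w x₀)
        = (T w + (B x₀ w + B (x - x₀) w + (B w x₀ + B w (x - x₀)))) - (B (x - x₀) w + B w (x - x₀)) := by abel
      _ = -(B (x - x₀) w + B w (x - x₀)) := by rw [hw, zero_sub]
  have h2 : ‖L w‖ ≤ 2 * C * ‖x - x₀‖ * ‖w‖ := by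
    rw [h1, norm_neg]
    refine (norm_add_le _ _).trans ?_
    have b1 : ‖B (x - x₀) w‖ ≤ C * ‖x - x₀‖ * ‖w‖ := hC (x - x₀) w
    have b2 : ‖B w (x - x₀)‖ ≤ C * ‖w‖ * ‖x - x₀‖ := hC w (x - x₀)
    nlinarith [b1, b2]
  have h3 : ‖w‖ ≤ M * ‖L w‖ := by
    have h := (L.symm : E →L[ℝ] E).le_opNorm (L w)
    simpa using h
  by_contra hne
  have hwpos : 0 < ‖w‖ := norm_pos_iff.2 hne
  have h4 : ‖w‖ ≤ M * (2 * C * ‖x - x₀‖) * ‖w‖ := by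
    calc ‖w‖ ≤ M * ‖L w‖ := h3
      _ ≤ M * (2 * C * ‖x - x₀‖ * ‖w‖) := mul_le_mul_of_nonneg_left h2 hM0
      _ = M * (2 * C * ‖x - x₀‖) * ‖w‖ := by ring
  have hlt : M * (2 * C * ‖x - x₀‖) < 1 := by
    calc M * (2 * C * ‖x - x₀‖) ≤ M * (2 * C * (2 * C * (M + 1))⁻¹) := by gcongr
      _ = M / (M + 1) := by field_simp
      _ < 1 := by rw [div_lt_one (by positivity)]; linarith
  nlinarith [h4, hlt, hwpos]

/-! ## §3 Force points and strict budgets -/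

/-- **Force points of the state space**: the Fourier family of a smooth divergence-free mean-zero
real force is (the coordinate family of) an element of `W`. -/
theorem loudOpen_exists_forcePoint (W : Submodule ℝ ℓ2)
    (hW : ∀ x : ℓ2, x ∈ W ↔ ((x : (Fin 3 → ℤ) → ℂ³) 0 = 0 ∧
      (∀ kk : Fin 3 → ℤ, kdot[kk, (x : (Fin 3 → ℤ) → ℂ³) kk] = 0) ∧ IsConjSymm (x : (Fin 3 → ℤ) → ℂ³)))
    {f : 𝕋³ → E³} (hf : IsSmooth f) (hdf : IsDivFree f) (h0 : HasZeroMean f) :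
    ∃ y : W, ((y : ℓ2) : (Fin 3 → ℤ) → ℂ³) = mFourierCoeff (complexify ∘ f) := by
  have hr : RapidDecay (mFourierCoeff (complexify ∘ f)) := hf.complexify_comp.rapidDecay_mFourierCoeff
  have hV : (mFourierCoeff (complexify ∘ f) : (Fin 3 → ℤ) → ℂ³) 0 = 0 ∧
      (∀ kk : Fin 3 → ℤ, kdot[kk, (mFourierCoeff (complexify ∘ f) : (Fin 3 → ℤ) → ℂ³) kk] = 0) ∧
      IsConjSymm (mFourierCoeff (complexify ∘ f) : (Fin 3 → ℤ) → ℂ³) :=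
    ⟨mFourierCoeff_complexify_zero_of_hasZeroMean hf h0, fun kk => hdf.sum_mul_mFourierCoeff_eq_zero hf kk,
      isConjSymm_mFourierCoeff hf.integrable⟩
  exact ⟨⟨⟨mFourierCoeff (complexify ∘ f), memℓp_two_of_rapidDecay hr⟩, (hW _).2 hV⟩, rfl⟩

/-- The squared distance of two points of `W` is the `ℓ²` sum of their coordinate differences. -/
theorem loudOpen_norm_sub_sq_eq_tsum {W : Submodule ℝ ℓ2} (y y' : W) :
    ‖y - y'‖ ^ 2 = ∑' k, ‖((y : ℓ2) : (Fin 3 → ℤ) → ℂ³) k - ((y' : ℓ2) : (Fin 3 → ℤ) → ℂ³) k‖ ^ 2 := by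
  rw [← norm_coeW, l2_norm_sq_eq_tsum]
  rfl

/-- **Strict budgets persist under `H¹`-small smooth perturbations** (registered helper sub-goal
`loudOpen_budgetRadius` of stub `stub_nondegenerateLoudOpen`): if `∫|u₀|² < E` and `ε < ν‖∇u₀‖²`,
there is `δ > 0` such that every smooth `v` with `∫|v − u₀|² + ‖∇(v − u₀)‖² < δ` has `∫|v|² < E`
and `ε < ν‖∇v‖²` (by contradiction from the sequential continuity `stub_normsOfH1Limit`). -/
theorem loudOpen_budgetRadius :
    ∀ (u₀ : UnitAddTorus (Fin 3) → EuclideanSpace ℝ (Fin 3)) (ν E ε : ℝ), IsSmooth u₀ →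
      ∫ x, ‖u₀ x‖ ^ 2 < E → ε < ν * gradNormSq u₀ →
        ∃ δ : ℝ, 0 < δ ∧ ∀ v : UnitAddTorus (Fin 3) → EuclideanSpace ℝ (Fin 3), IsSmooth v →
          (∫ x, ‖v x - u₀ x‖ ^ 2) + gradNormSq (fun x => v x - u₀ x) < δ →
            ∫ x, ‖v x‖ ^ 2 < E ∧ ε < ν * gradNormSq v := by
  intro u₀ ν E ε hu₀ hE hε
  by_contra hcon
  have hstep : ∀ n : ℕ, ∃ v : 𝕋³ → E³, IsSmooth v ∧
      (∫ x, ‖v x - u₀ x‖ ^ 2) + gradNormSq (fun x => v x - u₀ x) < 1 / ((n : ℝ) + 1) ∧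
        ¬ (∫ x, ‖v x‖ ^ 2 < E ∧ ε < ν * gradNormSq v) := by
    intro n
    by_contra h
    refine hcon ⟨1 / ((n : ℝ) + 1), by positivity, fun v hv hd => ?_⟩
    by_contra h'
    exact h ⟨v, hv, hd, h'⟩
  choose V hVs hVd hVb using hstep
  have hlim : Tendsto (fun n => (∫ x, ‖V n x - u₀ x‖ ^ 2) + gradNormSq (fun x => V n x - u₀ x)) atTop (𝓝 0) := by
    refine tendsto_of_tendsto_of_tendsto_of_le_of_le tendsto_const_nhds tendsto_one_div_add_atTop_nhds_zero_nat
      (fun n => add_nonneg (integral_nonneg fun x => by positivity) (gradNormSq_nonneg _)) fun n => (hVd n).le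
  obtain ⟨h1, h2⟩ := stub_normsOfH1Limit u₀ V hu₀ hVs hlim
  have e1 : ∀ᶠ n in atTop, ∫ x, ‖V n x‖ ^ 2 < E := h1.eventually_lt_const hE
  have e2 : ∀ᶠ n in atTop, ε < ν * gradNormSq (V n) := (h2.const_mul ν).eventually_const_lt hε
  obtain ⟨n, hn1, hn2⟩ := (e1.and e2).exists
  exact hVb n ⟨hn1, hn2⟩

end Summit.AnomalousDissipation.AnomalousDissipation.Theorems.WindLineWindyGalerkinSteadyZerothLaw

end
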